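import Summits.QuantumFields.BalabanUV.Beta.GAN24.CouplingCurveTaylor
import Summits.QuantumFields.BalabanUV.T4Continuum.Support.AbelianCovariantLaplacian

/-!
# `BalabanUV.Beta.GAN24.CovariantCurveTaylor` — binder row G-an2-4 ∕ (CONV-C), route R7 «TWO CURRENCIES», PART 242: THE EXACT ABELIAN COVARIANT VECTOR LAPLACIAN ALONG A SMOOTH
# CURVE OF TRANSPORTERS — for ANY volume-indexed family of ENTRYWISE `C^∞` real curves of abelian transporters `s ↦ U_{t,s}` with `U_{t,0} = 1`, EVERY s-derivative at `s = 0` of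
# the inverse effective covariance `(c_k(s))⁻¹`, `c_k(s) = L^{dk}Q_k(Δ_a^{(k)} + (Δ^{U_{t,s},(k)} − Δ^{1,(k)}))⁻¹Q_kᴴ`, has the β-cell's whole `LimitRate` END on `ℤ^d`, DISPLAYING ONLY the
# Lipschitz ∕ bounded-background constants of the first `N` jets `∂^j_s(−w_{t,s})|₀`, `∂^j_s z_{t,s}|₀` (`w = η⁻¹(U − 1)`, `z` the zeroth-order field) uniformly in the volume, and their EL₁.
# This is the census's «first-order MODEL framing» item CLOSED for the abelian covariant vector Laplacian: `Δ^{U_s} − Δ^1 = P(−w_s) + P(−w_s)ᴴ + diag z_s` is NE2's EXACT identity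
# `AbelianCovariantLaplacian.covPert_eq` (no model, no truncation, the background enters through `U_s` AND `U_s*`), the jets are the entrywise iterated derivatives, and PART 241 applies
# (unit b2b-balaban-gan24-p3, gen 65; v1)

NOT IN PRINT; OUR PROOF ([folklore] bookkeeping BY NAME over PART 241 (`conv_iteratedDeriv_invPertCov_couplingCurve_of_tendsto_background`), NE2's `AbelianCovariantLaplacian` (`covPert`,
`connV`, `zT`, `covPert_eq`, `conn`, `zfield`, `negConn`, `tauInv`), Mathlib's `ContDiff.differentiable_iteratedDeriv`, `iteratedDeriv_succ ∕ _zero`, `Complex.conjCLE`, `ContDiff.mul ∕ sub ∕ sum`;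
[Balaban1985BackgroundPropagators] (3.3) p. 390 and [Balaban1987RG1] (1.21)–(1.22) p. 264 LOCATE the shapes; nothing printed is a hypothesis).
HONEST FRAMING (cell contract, verbatim): «discharging `BetaPertH` makes Bałaban's UV stability UNCONDITIONAL — a real constructive-QFT result; it is NOT the
continuum limit and NOT the Clay problem.»  HONEST DEPENDENCY (verbatim): «continuum YM on T⁴ ⇐ BetaPertH ∧ nine spine estimates (0/9 proved); BetaPertH ⇐
(D1) ∧ (D4) ∧ CAP+tail; G-an2-4 gates asym, D1 and NE2/3/4.»

WHAT THIS FILE PROVES (0 sorry, 0 `def`):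
* §1 (scalar `C^∞` curves `ℝ → ℂ`) `hasDerivAt_iteratedDeriv_scalar` (the jet tower `∂_s(iteratedDeriv j f) = iteratedDeriv (j+1) f`), `contDiff_star_comp` (`s ↦ (f s)*` is `C^∞`),
  **`contDiff_conn`**, **`contDiff_zfield`** (the connection `w = η⁻¹(U − 1)` and the zeroth-order field `z` are entrywise `C^∞` along an entrywise `C^∞` transporter curve).
* §2 **`conv_iteratedDeriv_invCov_covariantCurve_of_tendsto`** (`d ≥ 3`, `L ≥ 2`, `a > 0`, `μ ≠ ν`, even cubic volumes `2(t+1)`, order `N`; `U_{t,s}` entrywise `C^∞`, `U_{t,0} = 1`; for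
  `j ≤ N` the jets `x ↦ ∂^j_s(−w_{t,s})(x)|₀` Lipschitz `(α, β)` and `x ↦ ∂^j_s z_{t,s}(x)|₀` bounded `(α′, β′)` uniformly in `t`, EL₁ displayed): the tower family
  `(t, k) ↦ ∂^N_s[(L^{dk}Q_k(Δ_a^{(k)} + covPert U_{t,s} k)⁻¹Q_kᴴ)⁻¹]|_{s=0}` has `∃ κ > 0, B, B′ ≥ 0, Π` with `IsInfiniteVolumeLimit`, `UniformDecay Π μ ν B (κ∕d)`,
  `StepRate Π μ ν B′ (κ∕d) (√(L⁻¹))`, `KernelInputs d Π`, `∀ k, |secondMoment (Π k) μ ν − secondMoment (limKernelOf Π) μ ν| ≤ β′_d(B′∕(1−√(L⁻¹)), κ∕d)·(√(L⁻¹))^k`.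
WHAT IT DOES NOT DO: derive the jets' Lipschitz ∕ bounded constants and EL₁ from those of a generator (e.g. `U_s = exp(sθ)`: `∂^j_s w|₀ = η^{j−1}(ηη⁻¹)…` — `w^{(j)}(0) = η⁻¹θ^j`, a follower's
one-page computation); several parameters (mixed partials = polarisation); Bałaban's `−∂P∂*` ∕ `aQ(U)*Q(U)` parts of `Δ_a(U)` and the non-abelian colour structure (NE2's tier B);
`d ≤ 2` ∕ odd volumes.  SUPPLIER work; NEVER «G-an2-4 closed»; NOT (CONV-C), NOT D1, NOT `BetaPertH`, NOT continuum, NOT Clay.  Records: `HOME/b2b-balaban-gan24-p3/gen65/README.md`.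
-/

noncomputable section

open scoped BigOperators ComplexConjugate Matrix Matrix.Norms.L2Operator
open Filter Topology

namespace Summit.QuantumFields.BalabanUV.Beta.GAN24.CovariantCurveTaylor

open Literature.MathematicalPhysics.QuantumFieldTheory.Balaban1983to89
open Literature.MathematicalPhysics.QuantumFieldTheory.Balaban1983to89.B5Prop11Plancherel (Tor fine)
open Literature.MathematicalPhysics.QuantumFieldTheory.Balaban1983to89.B5G183RateUnitTower (lev)
open Literature.MathematicalPhysics.QuantumFieldTheory.Balaban1983to89.B12Sec2to5 (betaPrime510)
open Literature.MathematicalPhysics.QuantumFieldTheory.Balaban1983to89.Beta (Site IsInfiniteVolumeLimit)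
open Literature.MathematicalPhysics.QuantumFieldTheory.Balaban1983to89.Beta.FreeLegDictionary (cubic)
open Literature.MathematicalPhysics.QuantumFieldTheory.Balaban1983to89.Beta.BlockKernelVolumeSockets (evenPeriod)
open Literature.MathematicalPhysics.QuantumFieldTheory.Balaban1983to89.Beta.VectorTails (castT)
open Literature.MathematicalPhysics.QuantumFieldTheory.Balaban1983to89.Beta.LimitRate (StepRate limKernelOf KernelInputs)
open Summit.QuantumFields.BalabanUV.T4Continuum
open Summit.QuantumFields.BalabanUV.T4Continuum.CovariantAveragingTower (avgTow)
open Summit.QuantumFields.BalabanUV.T4Continuum.BalabanAveragedTowerUnit (idx QBlev)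
open Summit.QuantumFields.BalabanUV.T4Continuum.BalabanAveragedCoerciveTower (unitIdx)
open Summit.QuantumFields.BalabanUV.T4Continuum.KingPairingPlantedLaw (calDalev)
open Summit.QuantumFields.BalabanUV.T4Continuum.FirstOrderBackgroundModel (LipschitzBackground Pmodel)
open Summit.QuantumFields.BalabanUV.T4Continuum.PerturbationAlgebra (BoundedBackground)
open Summit.QuantumFields.BalabanUV.T4Continuum.AbelianCovariantLaplacian (covPert connV zT covPert_eq conn zfield negConn tauInv)
open Summit.QuantumFields.BalabanUV.Beta.GAN24.CouplingCurveTaylor (conv_iteratedDeriv_invPertCov_couplingCurve_of_tendsto_background)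

variable {d : ℕ} (L : ℕ) [NeZero L]

/-! ## §1 Scalar smooth curves: the jet tower; the connection and the zeroth-order field along a smooth transporter curve -/

section Scalar

omit [NeZero L] in
/-- the jet tower of a `C^∞` scalar curve: `∂_s(iteratedDeriv j f) = iteratedDeriv (j+1) f`. [folklore] -/
theorem hasDerivAt_iteratedDeriv_scalar {f : ℝ → ℂ} (hf : ∀ n : ℕ, ContDiff ℝ n f) (j : ℕ) (s : ℝ) :
    HasDerivAt (iteratedDeriv j f) (iteratedDeriv (j + 1) f s) s := by
  have hdiff : Differentiable ℝ (iteratedDeriv j f) := ContDiff.differentiable_iteratedDeriv j (hf (j + 1)) (by exact_mod_cast Nat.lt_succ_self j)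
  rw [iteratedDeriv_succ]
  exact (hdiff s).hasDerivAt

omit [NeZero L] in
/-- `s ↦ (f s)*` is `C^n` for a `C^n` complex curve of a REAL parameter (`star = conj` is `ℝ`-linear continuous: `Complex.conjCLE`). [folklore] -/
theorem contDiff_star_comp {f : ℝ → ℂ} {n : ℕ} (hf : ContDiff ℝ n f) : ContDiff ℝ n (fun s => star (f s)) := by
  have e : (fun s => star (f s)) = ⇑Complex.conjCLE ∘ f := by
    funext s
    simp
  rw [e]
  exact Complex.conjCLE.contDiff.comp hf

variable (Nf : Fin d → ℕ) [hNf : ∀ μ, NeZero (Nf μ)]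

omit [NeZero L] hNf in
/-- **`contDiff_conn`** — the connection `w_ν(x) = c(U_ν(x) − 1)` is `C^n` in `s` along an entrywise `C^n` transporter curve. [folklore] -/
theorem contDiff_conn {u : ℝ → Fin d → (Tor Nf × Fin d → ℂ)} {n : ℕ} (hu : ∀ ν i, ContDiff ℝ n (fun s => u s ν i)) (c : ℂ) (ν : Fin d) (i : Tor Nf × Fin d) :
    ContDiff ℝ n (fun s => conn Nf c (u s) ν i) := by
  simp only [conn]
  exact contDiff_const.mul ((hu ν i).sub contDiff_const)

omit [NeZero L] hNf in
/-- **`contDiff_zfield`** — the zeroth-order field `z(x) = Σ_ν [|w_ν|²(x − e_ν) − c(w_ν(x) − w_ν(x − e_ν)) − c(w̄_ν(x) − w̄_ν(x − e_ν))]` is `C^n` in `s` along an entrywise `C^n` transporter curve.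
[folklore] -/
theorem contDiff_zfield {u : ℝ → Fin d → (Tor Nf × Fin d → ℂ)} {n : ℕ} (hu : ∀ ν i, ContDiff ℝ n (fun s => u s ν i)) (c : ℂ) (i : Tor Nf × Fin d) :
    ContDiff ℝ n (fun s => zfield Nf c (u s) i) := by
  simp only [zfield]
  refine ContDiff.sum fun ν _ => ?_
  have h1 := contDiff_conn Nf hu c ν (tauInv Nf ν i)
  have h2 := contDiff_conn Nf hu c ν i
  exact (((contDiff_star_comp h1).mul h1).sub (contDiff_const.mul (h2.sub h1))).sub (contDiff_const.mul ((contDiff_star_comp h2).sub (contDiff_star_comp h1)))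

end Scalar

/-! ## §2 THE INSTANCE: the exact abelian covariant Laplacian along a smooth transporter curve through `U = 1` -/

section Covariant

variable (a : ℝ) (ha : 0 < a)

/-- **`conv_iteratedDeriv_invCov_covariantCurve_of_tendsto` — EVERY s-DERIVATIVE AT `s = 0` OF `(c_k(s))⁻¹` ALONG THE EXACT ABELIAN COVARIANT LAPLACIAN OF A SMOOTH TRANSPORTER CURVE
`U_{t,s}`, `U_{t,0} = 1`, ON `ℤ^d`** [our proof] (`d ≥ 3`, `L ≥ 2`, `a > 0`, `μ ≠ ν`, even cubic volumes `2(t+1)`, order `N`).  Data: for every volume `t`, a REAL curve of abelian transporters on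
every level, `U t s k ν x = U_{t,s}(x, x + η_ke_ν)`, ENTRYWISE `C^∞` in `s`, through the trivial background at `s = 0`.  Displayed: for `j ≤ N`, the jets
`x ↦ ∂^j_s(−w_{t,s})^{(k)}_ν(x)|₀` (`−w = connV U`) are Lipschitz backgrounds `(α, β)` and `x ↦ ∂^j_s z^{(k)}_{t,s}(x)|₀` (`z = zT U`) bounded backgrounds `(α′, β′)`, uniformly in `t`, with EL₁.
THEN the tower family `(t, k) ↦ ∂^N_s[(L^{dk}Q_k(Δ_a^{(k)} + (Δ^{U_{t,s},(k)} − Δ^{1,(k)}))⁻¹Q_kᴴ)⁻¹]|_{s=0}` (`Δ^{U} − Δ^{1} = covPert U`, NE2) has the β-cell's whole `LimitRate` END — PART 241 on the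
entrywise iterated-derivative jets (§1) and `covPert_eq`.  `N = 2` is the vacuum-polarisation order of the one-loop functional along the curve.
[cite: Balaban1985BackgroundPropagators, (3.3) p.390 (covariant derivative, shape); Balaban1987RG1, (1.20)–(1.22) p.264 (shapes)] -/
theorem conv_iteratedDeriv_invCov_covariantCurve_of_tendsto (hL : 2 ≤ L) (hd : 3 ≤ d) {μ ν : Fin d} (hne : μ ≠ ν) {α β α' β' : ℝ} (N : ℕ)
    {U : (t : ℕ) → ℝ → (k : ℕ) → Fin d → (idx L (cubic d (evenPeriod t)) k → ℂ)}
    (hU : ∀ t k ν' x, ∀ n : ℕ, ContDiff ℝ n (fun s => U t s k ν' x)) (hU0 : ∀ t, U t 0 = 1)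
    (hV : ∀ j, j ≤ N → ∀ t, LipschitzBackground L (cubic d (evenPeriod t))
      (fun k ν' x => iteratedDeriv j (fun s => connV L (cubic d (evenPeriod t)) (U t s) k ν' x) 0) α β)
    (hZ : ∀ j, j ≤ N → ∀ t, BoundedBackground L (cubic d (evenPeriod t)) (fun k x => iteratedDeriv j (fun s => zT L (cubic d (evenPeriod t)) (U t s) k x) 0) α' β')
    (hV1 : ∀ j, j ≤ N → ∀ k (ν' f : Fin d) (z : Fin d → ℤ), ∃ s' : ℂ,
      Tendsto (fun t => iteratedDeriv j (fun s => connV L (cubic d (evenPeriod t)) (U t s) k ν' (castT (cubic d (lev L k * evenPeriod t)) z, f)) 0) atTop (𝓝 s'))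
    (hZ1 : ∀ j, j ≤ N → ∀ k (f : Fin d) (z : Fin d → ℤ), ∃ s' : ℂ,
      Tendsto (fun t => iteratedDeriv j (fun s => zT L (cubic d (evenPeriod t)) (U t s) k (castT (cubic d (lev L k * evenPeriod t)) z, f)) 0) atTop (𝓝 s')) :
    ∃ κ B B' : ℝ, 0 < κ ∧ 0 ≤ B ∧ 0 ≤ B' ∧ ∃ Pinf : ℕ → B12Beta.Kernel d,
      (∀ k, IsInfiniteVolumeLimit evenPeriod
        (fun t μ' ν' (z : Site d (evenPeriod t)) =>
          ((iteratedDeriv N (fun s : ℝ => (avgTow (QBlev L (cubic d (evenPeriod t))) ((L : ℝ) ^ d)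
              (fun k' => (calDalev L (cubic d (evenPeriod t)) a ha k' + covPert L (cubic d (evenPeriod t)) (U t s) k')⁻¹) k)⁻¹) 0)
            ((unitIdx L (cubic d (evenPeriod t))).symm (z, μ')) ((unitIdx L (cubic d (evenPeriod t))).symm (0, ν'))).re) (Pinf k)) ∧
      Beta.LimitRate.UniformDecay Pinf μ ν B (κ / d) ∧ StepRate Pinf μ ν B' (κ / d) (Real.sqrt ((L : ℝ)⁻¹)) ∧
      (∃ K : KernelInputs d Pinf, K.θ = Real.sqrt ((L : ℝ)⁻¹) ∧ K.c₀ = betaPrime510 d (B' / (1 - Real.sqrt ((L : ℝ)⁻¹))) (κ / d) ∧ K.Pinf = limKernelOf Pinf ∧ K.μ = μ ∧ K.ν = ν) ∧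
      (∀ k, |B12Beta.secondMoment (Pinf k) μ ν - B12Beta.secondMoment (limKernelOf Pinf) μ ν|
          ≤ betaPrime510 d (B' / (1 - Real.sqrt ((L : ℝ)⁻¹))) (κ / d) * Real.sqrt ((L : ℝ)⁻¹) ^ k) := by
  -- the entrywise jets of `−w` and `z`
  have hcV : ∀ t k (ν' : Fin d) (x : idx L (cubic d (evenPeriod t)) k) (n : ℕ), ContDiff ℝ n (fun s => connV L (cubic d (evenPeriod t)) (U t s) k ν' x) := by
    intro t k ν' x n
    simp only [connV, negConn]
    exact (contDiff_conn (fine (lev L k) (cubic d (evenPeriod t))) (u := fun s => U t s k) (fun ν i => hU t k ν i n) _ ν' x).neg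
  have hcZ : ∀ t k (x : idx L (cubic d (evenPeriod t)) k) (n : ℕ), ContDiff ℝ n (fun s => zT L (cubic d (evenPeriod t)) (U t s) k x) := by
    intro t k x n
    simp only [zT]
    exact contDiff_zfield (fine (lev L k) (cubic d (evenPeriod t))) (u := fun s => U t s k) (fun ν i => hU t k ν i n) _ x
  have h := conv_iteratedDeriv_invPertCov_couplingCurve_of_tendsto_background L a ha hL hd hne N
    (V := fun j t s k ν' x => iteratedDeriv j (fun v => connV L (cubic d (evenPeriod t)) (U t v) k ν' x) s)
    (Z := fun j t s k x => iteratedDeriv j (fun v => zT L (cubic d (evenPeriod t)) (U t v) k x) s)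
    (fun j t s k ν' x => hasDerivAt_iteratedDeriv_scalar (hcV t k ν' x) j s) (fun j t s k x => hasDerivAt_iteratedDeriv_scalar (hcZ t k x) j s)
    (fun t => by
      funext k ν' x
      simp only [iteratedDeriv_zero, hU0 t, connV, negConn, conn, Pi.one_apply, sub_self, mul_zero, neg_zero, Pi.zero_apply])
    (fun t => by
      funext k x
      simp only [iteratedDeriv_zero, hU0 t, zT, zfield, conn, Pi.one_apply, sub_self, mul_zero, star_zero, Finset.sum_const_zero, Pi.zero_apply])
    hV hZ hV1 hZ1
  have e : ∀ t s k', covPert L (cubic d (evenPeriod t)) (U t s) k'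
      = Pmodel L (cubic d (evenPeriod t)) ((fun j t s k ν' x => iteratedDeriv j (fun v => connV L (cubic d (evenPeriod t)) (U t v) k ν' x) s) 0 t s) k'
        + (Pmodel L (cubic d (evenPeriod t)) ((fun j t s k ν' x => iteratedDeriv j (fun v => connV L (cubic d (evenPeriod t)) (U t v) k ν' x) s) 0 t s) k')ᴴ
        + Matrix.diagonal ((fun j t s k x => iteratedDeriv j (fun v => zT L (cubic d (evenPeriod t)) (U t v) k x) s) 0 t s k') := by
    intro t s k'
    have e1 : ((fun j t s k ν' x => iteratedDeriv j (fun v => connV L (cubic d (evenPeriod t)) (U t v) k ν' x) s) 0 t s) = connV L (cubic d (evenPeriod t)) (U t s) := by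
      funext k ν' x; simp only [iteratedDeriv_zero]
    have e2 : ((fun j t s k x => iteratedDeriv j (fun v => zT L (cubic d (evenPeriod t)) (U t v) k x) s) 0 t s k') = zT L (cubic d (evenPeriod t)) (U t s) k' := by
      funext x; simp only [iteratedDeriv_zero]
    rw [e1, e2]
    exact covPert_eq L (cubic d (evenPeriod t)) (U t s) k'
  simp only [e]
  exact h

end Covariant

end Summit.QuantumFields.BalabanUV.Beta.GAN24.CovariantCurveTaylor

end
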